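import Literature.Probability.LatticeModels.AizenmanWickCurrents
import Literature.Probability.LatticeModels.AizenmanWickBoundWalks
import Mathlib.Order.Fin.Tuple
import HarnessLib

/-!
# Aizenman's bound on the deviation from Wick's law by random currents — II: the excess of one Gaussian step

Topic `Literature/Probability/LatticeModels`; sequel of `AizenmanWickCurrents.lean` (notation from there: edge
couplings `K ≥ 0`, labelled points `x : ι → V`, `Z[A]`, the disjoint-cluster functional `𝔇(I;X) = dcMass`, the
unnormalised Gaussian functional `ℰ = epairing`, the defect `E = defect`, `m = min I`, `I_b = I ∖ {m,b}`).
Here the excess of one Gaussian step of `𝔇`,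

  `∑_{b} Z[{x_m}Δ{x_b}] 𝔇(I_b;∅) - 𝔇(I;∅) ≤ ∑_b ∑_{n : ∂n={x_m}Δ{x_b}} w(n) E(I_b; C_n(x_m))`      (`excess_le`),

is bounded by intersections of pairs of source clusters, i.e. by the double-current quantities

  `𝒫(a,b;c,d) = ∑ 𝟙[∂n₁={a}Δ{b}] 𝟙[∂n₂={c}Δ{d}] w w 𝟙[c ∈ C_{n₁+n₂}(a)] = -U₄(a,b,c,d) Z[∅]²/2`

of `WeightedCurrentsIdentities.ursellFour_currentSum_identity` — the tree's `Pint K a b c d` of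
`AizenmanWickBoundWalks.lean` (the random-walk route to the same proposition; imported for this one definition):
`∑_n w(n) E(J; C_n(a)) ≤ marked(J)` (`tsum_pairWeight_mul_defect_le`), where `marked F J` is the Gaussian
functional with one pair `{i,j}` marked by `F i j = 𝒫(x_m,x_b;x_i,x_j)`. The three pairings of a `4`-set give the
same `𝒫` (`Pint_swap_bc`, read off the Ursell identity), which is the source of Aizenman's
constant `3 · (1/2)|U₄| = (3/2)|U₄|`; the regrouping over `3`-subsets and the passage to ratios are in
`AizenmanWickCurrentsRatio.lean`.

## References

* M. Aizenman, Comm. Math. Phys. 86 (1982), Prop. 12.1, eqs. (12.5)–(12.7), Prop. 9.1 and eq. (9.16) (the factor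
  `3/2`: each of the three pairings contributes `|U₄|/2`) [AizenmanCMP1982] (read).
* R. Panis, arXiv:2309.05797 (2023), Prop. 4.6–4.7 [Panis2023Triviality].
-/

noncomputable section

open Finset Filter
open scoped symmDiff ENNReal

namespace Literature.Probability.LatticeModels

namespace Current

variable {V : Type*} [Fintype V] [DecidableEq V] {G : SimpleGraph V} [DecidableRel G.Adj]
variable {ι : Type*} [LinearOrder ι]
variable {K : G.edgeFinset → ℝ}

/-! ### The double-current pair-intersection term `𝒫 = Pint` -/

/-- `𝒫(a,b;c,d) ≤ Z[{a}Δ{b}] Z[{c}Δ{d}]` (in particular it is finite). [folklore] -/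
theorem Pint_le_mul (K : G.edgeFinset → ℝ) (a b c d : V) : Pint K a b c d ≤ ecurrentSum K ({a} ∆ {b}) * ecurrentSum K ({c} ∆ {d}) := by
  rw [← tsum_epairWeight]
  unfold Pint
  exact ENNReal.tsum_le_tsum fun q => by
    calc epairWeight K ({a} ∆ {b}) ({c} ∆ {d}) q * (if c ∈ (q.1 + q.2).cluster a then 1 else 0)
        ≤ epairWeight K ({a} ∆ {b}) ({c} ∆ {d}) q * 1 := mul_le_mul' le_rfl (by split_ifs <;> simp)
      _ = _ := mul_one _

/-- **The three values of `𝒫` on a `4`-set agree** (Aizenman 1982, Prop. 9.1: "each of the three terms … is a lower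
bound for `|U₄|`", here as identities), read off the Ursell identity
`Z[ab]Z[cd] + Z[ac]Z[bd] + Z[ad]Z[bc] = Z[abcd]Z[∅] + 2𝒫(a,b;c,d)` of `ursellFour_currentSum_identity`, whose left side
is symmetric in `b, c, d`: first `𝒫(a,b;c,d) = 𝒫(a,b;d,c)`. [cite: AizenmanCMP1982, Prop. 9.1 and eq. (9.16)] -/
theorem Pint_swap_cd (hK : ∀ e, 0 ≤ K e) (a b c d : V) : Pint K a b c d = Pint K a b d c := by
  have h1 : ecurrentSum K ({a} ∆ {b}) * ecurrentSum K ({c} ∆ {d}) + ecurrentSum K ({a} ∆ {c}) * ecurrentSum K ({b} ∆ {d}) +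
      ecurrentSum K ({a} ∆ {d}) * ecurrentSum K ({b} ∆ {c}) =
      ecurrentSum K ({a} ∆ ({b} ∆ ({c} ∆ {d}))) * ecurrentSum K ∅ + 2 * Pint K a b c d :=
    ursellFour_currentSum_identity hK a b c d
  have h2 : ecurrentSum K ({a} ∆ {b}) * ecurrentSum K ({d} ∆ {c}) + ecurrentSum K ({a} ∆ {d}) * ecurrentSum K ({b} ∆ {c}) +
      ecurrentSum K ({a} ∆ {c}) * ecurrentSum K ({b} ∆ {d}) =
      ecurrentSum K ({a} ∆ ({b} ∆ ({d} ∆ {c}))) * ecurrentSum K ∅ + 2 * Pint K a b d c :=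
    ursellFour_currentSum_identity hK a b d c
  rw [symmDiff_comm ({d} : Finset V) {c}] at h2
  have hL : ecurrentSum K ({a} ∆ {b}) * ecurrentSum K ({c} ∆ {d}) + ecurrentSum K ({a} ∆ {d}) * ecurrentSum K ({b} ∆ {c}) +
      ecurrentSum K ({a} ∆ {c}) * ecurrentSum K ({b} ∆ {d}) =
      ecurrentSum K ({a} ∆ {b}) * ecurrentSum K ({c} ∆ {d}) + ecurrentSum K ({a} ∆ {c}) * ecurrentSum K ({b} ∆ {d}) +
      ecurrentSum K ({a} ∆ {d}) * ecurrentSum K ({b} ∆ {c}) := by ring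
  rw [hL, h1] at h2
  have hfin : ecurrentSum K ({a} ∆ ({b} ∆ ({c} ∆ {d}))) * ecurrentSum K ∅ ≠ ∞ :=
    ENNReal.mul_ne_top (ecurrentSum_ne_top hK _) (ecurrentSum_ne_top hK _)
  have h3 := (ENNReal.add_right_inj hfin).1 h2
  exact (ENNReal.mul_right_inj two_ne_zero ENNReal.ofNat_ne_top).1 h3

/-- **Pairing independence of `𝒫`**: `𝒫(a,b;c,d) = 𝒫(a,c;b,d)`. [cite: AizenmanCMP1982, Prop. 9.1 and eq. (9.16)] -/
theorem Pint_swap_bc (hK : ∀ e, 0 ≤ K e) (a b c d : V) : Pint K a b c d = Pint K a c b d := by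
  have h1 : ecurrentSum K ({a} ∆ {b}) * ecurrentSum K ({c} ∆ {d}) + ecurrentSum K ({a} ∆ {c}) * ecurrentSum K ({b} ∆ {d}) +
      ecurrentSum K ({a} ∆ {d}) * ecurrentSum K ({b} ∆ {c}) =
      ecurrentSum K ({a} ∆ ({b} ∆ ({c} ∆ {d}))) * ecurrentSum K ∅ + 2 * Pint K a b c d :=
    ursellFour_currentSum_identity hK a b c d
  have h2 : ecurrentSum K ({a} ∆ {c}) * ecurrentSum K ({b} ∆ {d}) + ecurrentSum K ({a} ∆ {b}) * ecurrentSum K ({c} ∆ {d}) +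
      ecurrentSum K ({a} ∆ {d}) * ecurrentSum K ({c} ∆ {b}) =
      ecurrentSum K ({a} ∆ ({c} ∆ ({b} ∆ {d}))) * ecurrentSum K ∅ + 2 * Pint K a c b d :=
    ursellFour_currentSum_identity hK a c b d
  have hset : ({a} : Finset V) ∆ ({c} ∆ ({b} ∆ {d})) = {a} ∆ ({b} ∆ ({c} ∆ {d})) := by
    rw [symmDiff_left_comm ({c} : Finset V) {b} {d}]
  rw [hset, symmDiff_comm ({c} : Finset V) {b}] at h2
  have hL : ecurrentSum K ({a} ∆ {c}) * ecurrentSum K ({b} ∆ {d}) + ecurrentSum K ({a} ∆ {b}) * ecurrentSum K ({c} ∆ {d}) +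
      ecurrentSum K ({a} ∆ {d}) * ecurrentSum K ({b} ∆ {c}) =
      ecurrentSum K ({a} ∆ {b}) * ecurrentSum K ({c} ∆ {d}) + ecurrentSum K ({a} ∆ {c}) * ecurrentSum K ({b} ∆ {d}) +
      ecurrentSum K ({a} ∆ {d}) * ecurrentSum K ({b} ∆ {c}) := by ring
  rw [hL, h1] at h2
  have hfin : ecurrentSum K ({a} ∆ ({b} ∆ ({c} ∆ {d}))) * ecurrentSum K ∅ ≠ ∞ :=
    ENNReal.mul_ne_top (ecurrentSum_ne_top hK _) (ecurrentSum_ne_top hK _)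
  have h3 := (ENNReal.add_right_inj hfin).1 h2
  exact (ENNReal.mul_right_inj two_ne_zero ENNReal.ofNat_ne_top).1 h3

omit [DecidableEq V] in
/-- If the cluster of `u` in `n'` meets the cluster of `a` in `n`, then `u ∈ C_{n+n'}(a)`. [folklore] -/
theorem mem_cluster_add_of_not_disjoint {n n' : Current G} {a u : V}
    (h : ¬ Disjoint (n'.cluster u) (n.cluster a)) : u ∈ (n + n').cluster a := by
  obtain ⟨v, hvu, hva⟩ := Finset.not_disjoint_iff.1 h
  have hva' : v ∈ (n + n').cluster a := cluster_mono (self_le_add_right n n') a hva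
  have huv : u ∈ n'.cluster v := mem_cluster_comm.1 hvu
  have huv' : u ∈ (n + n').cluster v := cluster_mono (self_le_add_left n' n) v huv
  exact mem_cluster_trans hva' huv'

/-- **The source-cluster intersection is a double-current connection**:
`∑_n 𝟙[∂n={a}Δ{c}] w(n) ∑_{n' : ∂n'={u}Δ{v}, C_{n'}(u) ∩ C_n(a) ≠ ∅} w(n') ≤ 𝒫(a,c;u,v)`. [cite: AizenmanCMP1982, Prop. 12.1 (proof, eq. (12.7))] -/
theorem tsum_pairWeight_mul_tsum_hitWeight_le (K : G.edgeFinset → ℝ) (a c u v : V) :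
    ∑' n : Current G, (if n.sources = {a} ∆ {c} then n.eweight K else 0) *
        ∑' n' : Current G, hitWeight K u v (n.cluster a) n' ≤ Pint K a c u v := by
  unfold Pint
  simp_rw [← ENNReal.tsum_mul_left]
  rw [← ENNReal.tsum_prod]
  refine ENNReal.tsum_le_tsum fun q => ?_
  unfold hitWeight epairWeight
  by_cases h1 : q.1.sources = {a} ∆ {c}
  · by_cases h2 : q.2.sources = {u} ∆ {v} ∧ ¬ Disjoint (q.2.cluster u) (q.1.cluster a)
    · rw [if_pos h1, if_pos h2, if_pos ⟨h1, h2.1⟩, if_pos (mem_cluster_add_of_not_disjoint h2.2), mul_one]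
    · rw [if_neg h2, mul_zero]; exact bot_le
  · rw [if_neg h1, zero_mul]; exact bot_le

/-! ### The marked Gaussian functional and the bound on the defect -/

section Marked

variable (K) (x : ι → V)

/-- **The Gaussian functional with one marked pair**: `marked F ∅ = 0`,
`marked F J = ∑_{b∈J∖m} [F m b · ℰ(J∖{m,b}) + Z[{x_m}Δ{x_b}] · marked F (J∖{m,b})]` (`m = min J`) — the sum over
the pairings of `J` of the products of `Z[pair]` with exactly one pair `{i,j}` weighted instead by `F i j`, the
marked pair being created at the stage where `i` is the least remaining label. [folklore] -/
def marked (F : ι → ι → ℝ≥0∞) (J : Finset ι) : ℝ≥0∞ :=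
  if hJ : J.Nonempty then
    ∑ b ∈ (J.erase (J.min' hJ)).attach,
      (F (J.min' hJ) b * epairing K x ((J.erase (J.min' hJ)).erase b) +
        ecurrentSum K ({x (J.min' hJ)} ∆ {x b}) * marked F ((J.erase (J.min' hJ)).erase b))
  else 0
termination_by J.card
decreasing_by exact card_erase_erase_lt hJ b

variable {K x}

/-- `marked F ∅ = 0`. [folklore] -/
@[simp] theorem marked_empty (F : ι → ι → ℝ≥0∞) : marked K x F (∅ : Finset ι) = 0 := by
  rw [marked, dif_neg Finset.not_nonempty_empty]

/-- The recursion of `marked` at the least element. [folklore] -/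
theorem marked_eq (F : ι → ι → ℝ≥0∞) {J : Finset ι} (hJ : J.Nonempty) :
    marked K x F J = ∑ b ∈ J.erase (J.min' hJ),
      (F (J.min' hJ) b * epairing K x ((J.erase (J.min' hJ)).erase b) +
        ecurrentSum K ({x (J.min' hJ)} ∆ {x b}) * marked K x F ((J.erase (J.min' hJ)).erase b)) := by
  rw [marked, dif_pos hJ, Finset.sum_attach (J.erase (J.min' hJ)) (fun b =>
    F (J.min' hJ) b * epairing K x ((J.erase (J.min' hJ)).erase b) +
      ecurrentSum K ({x (J.min' hJ)} ∆ {x b}) * marked K x F ((J.erase (J.min' hJ)).erase b))]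

end Marked

/-- **The defect against a source cluster is bounded by the marked functional**: for a pair current `n`
(`∂n = {a}Δ{c}`) and every label set `J`,
`∑_n 𝟙[∂n={a}Δ{c}] w(n) E(J; C_n(a)) ≤ marked [𝒫(a,c;x_·,x_·)] (J)` — following the recursion of `E`, the cluster
that meets `C_n(a)` yields a double-current connection (`tsum_pairWeight_mul_tsum_hitWeight_le`).
[cite: AizenmanCMP1982, Prop. 12.1 (proof, eqs. (12.5)–(12.7))] -/
theorem tsum_pairWeight_mul_defect_le (x : ι → V) (a c : V) :
    ∀ J : Finset ι, ∑' n : Current G, (if n.sources = {a} ∆ {c} then n.eweight K else 0) * defect K x J (n.cluster a) ≤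
      marked K x (fun i j => Pint K a c (x i) (x j)) J := by
  intro J
  induction J using Finset.strongInduction with
  | H J ih =>
    by_cases hJ : J.Nonempty
    swap
    · rw [Finset.not_nonempty_iff_eq_empty.1 hJ, marked_empty]
      simp only [defect_empty, mul_zero, tsum_zero, le_refl]
    set m' := J.min' hJ with hm'
    set pw : Current G → ℝ≥0∞ := fun n => if n.sources = {a} ∆ {c} then n.eweight K else 0 with hpw
    rw [marked_eq _ hJ]
    simp_rw [defect_eq hJ]
    calc ∑' n : Current G, pw n * ∑ b ∈ J.erase m',
          ((∑' n' : Current G, hitWeight K (x m') (x b) (n.cluster a) n') * epairing K x ((J.erase m').erase b) +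
            ecurrentSum K ({x m'} ∆ {x b}) * defect K x ((J.erase m').erase b) (n.cluster a))
        = ∑ b ∈ J.erase m', ∑' n : Current G, pw n *
          ((∑' n' : Current G, hitWeight K (x m') (x b) (n.cluster a) n') * epairing K x ((J.erase m').erase b) +
            ecurrentSum K ({x m'} ∆ {x b}) * defect K x ((J.erase m').erase b) (n.cluster a)) := by
          rw [← Summable.tsum_finsetSum (fun _ _ => ENNReal.summable)]
          exact tsum_congr fun n => Finset.mul_sum _ _ _
      _ ≤ ∑ b ∈ J.erase m', (Pint K a c (x m') (x b) * epairing K x ((J.erase m').erase b) +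
            ecurrentSum K ({x m'} ∆ {x b}) * marked K x (fun i j => Pint K a c (x i) (x j)) ((J.erase m').erase b)) := by
          refine Finset.sum_le_sum fun b _ => ?_
          set J' := (J.erase m').erase b with hJ'
          have hsplit : ∑' n : Current G, pw n *
              ((∑' n' : Current G, hitWeight K (x m') (x b) (n.cluster a) n') * epairing K x J' +
                ecurrentSum K ({x m'} ∆ {x b}) * defect K x J' (n.cluster a)) =
              (∑' n : Current G, pw n * ∑' n' : Current G, hitWeight K (x m') (x b) (n.cluster a) n') * epairing K x J' +
                ecurrentSum K ({x m'} ∆ {x b}) * ∑' n : Current G, pw n * defect K x J' (n.cluster a) := by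
            rw [← ENNReal.tsum_mul_right, ← ENNReal.tsum_mul_left, ← ENNReal.tsum_add]
            exact tsum_congr fun n => by ring
          rw [hsplit]
          exact add_le_add (mul_le_mul' (tsum_pairWeight_mul_tsum_hitWeight_le K a c _ _) le_rfl)
            (mul_le_mul' le_rfl (ih J' (erase_erase_ssubset (J.min'_mem hJ) b)))

/-! ### The excess of one Gaussian step -/

/-- **The excess of one Gaussian step of `𝔇` is controlled by marked functionals**: with `m = min I`,
`I_b = I∖{m,b}`,
`∑_{b∈I∖m} Z[{x_m}Δ{x_b}] 𝔇(I_b;∅) ≤ 𝔇(I;∅) + ∑_{b∈I∖m} marked[𝒫(x_m,x_b;x_·,x_·)](I_b)`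
(the defect bound `dcMass_le_dcMass_union_add_defect` with `X = C_n(x_m)`, then `tsum_pairWeight_mul_defect_le`).
[cite: AizenmanCMP1982, Prop. 12.1 (proof, eq. (12.5))] -/
theorem gaussianStep_dcMass_le (x : ι → V) {I : Finset ι} (hI : I.Nonempty) :
    ∑ b ∈ I.erase (I.min' hI), ecurrentSum K ({x (I.min' hI)} ∆ {x b}) * dcMass K x ((I.erase (I.min' hI)).erase b) ∅ ≤
      dcMass K x I ∅ + ∑ b ∈ I.erase (I.min' hI),
        marked K x (fun i j => Pint K (x (I.min' hI)) (x b) (x i) (x j)) ((I.erase (I.min' hI)).erase b) := by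
  set m := I.min' hI with hm
  rw [dcMass_eq hI ∅, ← Finset.sum_add_distrib]
  refine Finset.sum_le_sum fun b _ => ?_
  set J := (I.erase m).erase b with hJ
  calc ecurrentSum K ({x m} ∆ {x b}) * dcMass K x J ∅
      = ∑' n : Current G, (if n.sources = {x m} ∆ {x b} then n.eweight K else 0) * dcMass K x J ∅ := by
        rw [ecurrentSum, ENNReal.tsum_mul_right]
    _ ≤ ∑' n : Current G, (if n.sources = {x m} ∆ {x b} then n.eweight K else 0) *
          (dcMass K x J (∅ ∪ n.cluster (x m)) + defect K x J (n.cluster (x m))) :=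
        ENNReal.tsum_le_tsum fun n => mul_le_mul' le_rfl (dcMass_le_dcMass_union_add_defect x J ∅ _)
    _ = ∑' n : Current G, avoidWeight K (x m) (x b) ∅ n * dcMass K x J (∅ ∪ n.cluster (x m)) +
          ∑' n : Current G, (if n.sources = {x m} ∆ {x b} then n.eweight K else 0) * defect K x J (n.cluster (x m)) := by
        rw [← ENNReal.tsum_add]
        exact tsum_congr fun n => by rw [mul_add, avoidWeight_empty]
    _ ≤ _ := add_le_add le_rfl (tsum_pairWeight_mul_defect_le x (x m) (x b) J)

/-! ### Combinatorics: the closed form of `marked`, symmetric functions of three labels, sorted `4`-sets -/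

omit [Fintype V] [DecidableEq V] [DecidableRel G.Adj] in
/-- Exchanging the two summations over ordered pairs of distinct elements. [folklore] -/
theorem sum_erase_comm {M : Type*} [AddCommMonoid M] (T : Finset ι) (g : ι → ι → M) :
    ∑ i ∈ T, ∑ j ∈ T.erase i, g i j = ∑ j ∈ T, ∑ i ∈ T.erase j, g i j :=
  Finset.sum_comm' fun i j => by
    simp only [Finset.mem_erase]
    tauto

/-- `ℰ(insert m S) = ∑_{b∈S} Z[{x_m}Δ{x_b}] ℰ(S∖b)` when `m` is below `S`. [folklore] -/
theorem epairing_insert {x : ι → V} {S : Finset ι} {m : ι} (hm : ∀ i ∈ S, m < i) :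
    epairing K x (insert m S) = ∑ b ∈ S, ecurrentSum K ({x m} ∆ {x b}) * epairing K x (S.erase b) := by
  have hmS : m ∉ S := fun h => lt_irrefl m (hm m h)
  have hne : (insert m S).Nonempty := Finset.insert_nonempty m S
  have hmin : (insert m S).min' hne = m :=
    le_antisymm (Finset.min'_le _ _ (Finset.mem_insert_self m S))
      (Finset.le_min' _ _ _ fun y hy => by
        rcases Finset.mem_insert.1 hy with rfl | hy
        · exact le_rfl
        · exact (hm y hy).le)
  rw [epairing_eq hne]
  simp only [hmin, Finset.erase_insert hmS]

/-- **The closed form of the marked functional** for a symmetric mark `F`: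
`∑_{i∈J} ∑_{j∈J∖i} F i j · ℰ(J∖{i,j}) = 2 · marked F J` (each unordered pair `{i,j}` of `J` marked once, the
rest of `J` paired freely). [folklore] -/
theorem sum_sum_mul_epairing_eq_two_mul_marked (x : ι → V) (F : ι → ι → ℝ≥0∞) (hF : ∀ i j, F i j = F j i) :
    ∀ J : Finset ι, ∑ i ∈ J, ∑ j ∈ J.erase i, F i j * epairing K x ((J.erase i).erase j) = 2 * marked K x F J := by
  intro J
  induction J using Finset.strongInduction with
  | H J ih =>
    by_cases hJ : J.Nonempty
    swap
    · rw [Finset.not_nonempty_iff_eq_empty.1 hJ, marked_empty, Finset.sum_empty, mul_zero]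
    set m := J.min' hJ with hm
    set J₁ := J.erase m with hJ₁
    have hmJ : m ∈ J := J.min'_mem hJ
    have hmJ₁ : m ∉ J₁ := Finset.notMem_erase m J
    have hJeq : J = insert m J₁ := (Finset.insert_erase hmJ).symm
    have hlt : ∀ i ∈ J₁, m < i := fun i hi =>
      lt_of_le_of_ne (Finset.min'_le J i (Finset.mem_of_mem_erase hi)) (Finset.ne_of_mem_erase hi).symm
    -- expand the left side at `m`
    have hL : ∑ i ∈ J, ∑ j ∈ J.erase i, F i j * epairing K x ((J.erase i).erase j) =
        2 * ∑ j ∈ J₁, F m j * epairing K x (J₁.erase j) +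
          ∑ i ∈ J₁, ∑ j ∈ J₁.erase i, ∑ b ∈ (J₁.erase i).erase j,
            F i j * (ecurrentSum K ({x m} ∆ {x b}) * epairing K x (((J₁.erase i).erase j).erase b)) := by
      rw [hJeq, Finset.sum_insert hmJ₁, Finset.erase_insert hmJ₁]
      have hi : ∀ i ∈ J₁, ∑ j ∈ (insert m J₁).erase i, F i j * epairing K x (((insert m J₁).erase i).erase j) =
          F m i * epairing K x (J₁.erase i) +
            ∑ j ∈ J₁.erase i, ∑ b ∈ (J₁.erase i).erase j,
              F i j * (ecurrentSum K ({x m} ∆ {x b}) * epairing K x (((J₁.erase i).erase j).erase b)) := by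
        intro i hi
        have him : i ≠ m := fun h => hmJ₁ (h ▸ hi)
        have hmi : m ∉ J₁.erase i := fun h => hmJ₁ (Finset.mem_of_mem_erase h)
        rw [Finset.erase_insert_of_ne (Ne.symm him), Finset.sum_insert hmi, Finset.erase_insert hmi, hF i m]
        congr 1
        refine Finset.sum_congr rfl fun j hj => ?_
        have hjm : j ≠ m := fun h => hmi (h ▸ hj)
        have hmij : ∀ b ∈ (J₁.erase i).erase j, m < b := fun b hb =>
          hlt b (Finset.mem_of_mem_erase (Finset.mem_of_mem_erase hb))
        rw [Finset.erase_insert_of_ne (Ne.symm hjm), epairing_insert hmij, Finset.mul_sum]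
      rw [Finset.sum_congr rfl hi, Finset.sum_add_distrib, two_mul, add_assoc]
    -- expand the right side by the induction hypothesis
    have hR : 2 * marked K x F J = 2 * ∑ b ∈ J₁, F m b * epairing K x (J₁.erase b) +
        ∑ b ∈ J₁, ∑ i ∈ J₁.erase b, ∑ j ∈ (J₁.erase b).erase i,
          ecurrentSum K ({x m} ∆ {x b}) * (F i j * epairing K x (((J₁.erase b).erase i).erase j)) := by
      rw [marked_eq F hJ, ← hm, ← hJ₁, Finset.mul_sum, Finset.mul_sum, ← Finset.sum_add_distrib]
      refine Finset.sum_congr rfl fun b hb => ?_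
      rw [mul_add]
      congr 1
      rw [mul_left_comm, ← ih (J₁.erase b) (hJ₁ ▸ erase_erase_ssubset hmJ b), Finset.mul_sum]
      exact Finset.sum_congr rfl fun i _ => Finset.mul_sum _ _ _
    rw [hL, hR]
    congr 1
    -- reorder the triple sum `(i,j,b) ↦ (b,i,j)`
    calc ∑ i ∈ J₁, ∑ j ∈ J₁.erase i, ∑ b ∈ (J₁.erase i).erase j,
          F i j * (ecurrentSum K ({x m} ∆ {x b}) * epairing K x (((J₁.erase i).erase j).erase b))
        = ∑ i ∈ J₁, ∑ b ∈ J₁.erase i, ∑ j ∈ (J₁.erase i).erase b,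
          F i j * (ecurrentSum K ({x m} ∆ {x b}) * epairing K x (((J₁.erase i).erase j).erase b)) :=
          Finset.sum_congr rfl fun i _ => sum_erase_comm (J₁.erase i) _
      _ = ∑ b ∈ J₁, ∑ i ∈ J₁.erase b, ∑ j ∈ (J₁.erase i).erase b,
          F i j * (ecurrentSum K ({x m} ∆ {x b}) * epairing K x (((J₁.erase i).erase j).erase b)) :=
          sum_erase_comm J₁ _
      _ = _ := by
          refine Finset.sum_congr rfl fun b _ => Finset.sum_congr rfl fun i _ => ?_
          rw [Finset.erase_right_comm (a := i) (b := b)]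
          refine Finset.sum_congr rfl fun j _ => ?_
          rw [Finset.erase_right_comm (a := j) (b := b), Finset.erase_right_comm (a := i) (b := b)]
          ring

omit [Fintype V] [DecidableEq V] [DecidableRel G.Adj] in
/-- **A symmetric function of three distinct labels only depends on their set**: it equals its value at the
increasing enumeration of `{b, i, j}`. [folklore] -/
theorem symm3_eq_apply_orderEmbOfFin {β : Type*} (f : ι → ι → ι → β) (h12 : ∀ p q r, f p q r = f q p r)
    (h23 : ∀ p q r, f p q r = f p r q) {b i j : ι} (h3 : ({b, i, j} : Finset ι).card = 3) :
    f b i j = f (({b, i, j} : Finset ι).orderEmbOfFin h3 0) (({b, i, j} : Finset ι).orderEmbOfFin h3 1)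
      (({b, i, j} : Finset ι).orderEmbOfFin h3 2) := by
  set e := ({b, i, j} : Finset ι).orderEmbOfFin h3 with he
  have hmem : ∀ k : Fin 3, e k = b ∨ e k = i ∨ e k = j := fun k => by
    have h := Finset.orderEmbOfFin_mem ({b, i, j} : Finset ι) h3 k
    simpa only [Finset.mem_insert, Finset.mem_singleton] using h
  have h01 : (0 : Fin 3) ≠ 1 := by decide
  have h02 : (0 : Fin 3) ≠ 2 := by decide
  have h12' : (1 : Fin 3) ≠ 2 := by decide
  rcases hmem 0 with h0 | h0 | h0 <;> rcases hmem 1 with h1 | h1 | h1 <;> rcases hmem 2 with h2 | h2 | h2 <;>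
    first
    | exact absurd (e.injective (h0.trans h1.symm)) h01
    | exact absurd (e.injective (h0.trans h2.symm)) h02
    | exact absurd (e.injective (h1.trans h2.symm)) h12'
    | (rw [h0, h1, h2] <;>
       first
       | exact h23 _ _ _
       | exact h12 _ _ _
       | exact (h12 _ _ _).trans (h23 _ _ _)
       | exact (h23 _ _ _).trans (h12 _ _ _)
       | exact ((h12 _ _ _).trans (h23 _ _ _)).trans (h12 _ _ _))

omit [Fintype V] [DecidableEq V] [DecidableRel G.Adj] in
/-- The increasing enumeration of `insert m t` for `m` below `t` is `m` followed by that of `t`. [folklore] -/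
theorem orderEmbOfFin_insert_eq_vecCons {t : Finset ι} {k : ℕ} (ht : t.card = k + 1) {m : ι}
    (hm : ∀ i ∈ t, m < i) (h : (insert m t).card = k + 2) :
    ((insert m t).orderEmbOfFin h : Fin (k + 2) → ι) = Matrix.vecCons m (t.orderEmbOfFin ht) := by
  symm
  refine Finset.orderEmbOfFin_unique h (fun l => ?_) ?_
  · refine Fin.cases ?_ (fun l => ?_) l
    · exact Finset.mem_insert_self m t
    · simp only [Matrix.cons_val_succ]
      exact Finset.mem_insert_of_mem (Finset.orderEmbOfFin_mem t ht l)
  · exact (t.orderEmbOfFin ht).strictMono.vecCons (hm _ (Finset.orderEmbOfFin_mem t ht 0))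

omit [Fintype V] [DecidableEq V] [DecidableRel G.Adj] in
/-- `((S ∖ b) ∖ i) ∖ j = S ∖ {b,i,j}`. [folklore] -/
theorem erase_erase_erase_eq_sdiff (S : Finset ι) (b i j : ι) :
    ((S.erase b).erase i).erase j = S \ {b, i, j} := by
  ext w
  simp only [Finset.mem_erase, Finset.mem_sdiff, Finset.mem_insert, Finset.mem_singleton]
  tauto

/-! ### The excess in terms of `4`-subsets -/

section FourSets

variable (K) (x : ι → V)

/-- **The pair-intersection term of a `4`-set of labels**, evaluated at its increasing enumeration `s₀<s₁<s₂<s₃`: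
`𝒫₄(s) = 𝒫(x_{s₀},x_{s₁};x_{s₂},x_{s₃})` (`= |U₄(x_{s₀},…,x_{s₃})| Z[∅]²/2`); `0` if `|s| ≠ 4`.
[cite: AizenmanCMP1982, Prop. 12.1 (the terms U₄(x_j,x_k,x_l,x_m) of R_{2n})] -/
def pfour (s : Finset ι) : ℝ≥0∞ :=
  if h : s.card = 4 then
    Pint K (x (s.orderEmbOfFin h 0)) (x (s.orderEmbOfFin h 1)) (x (s.orderEmbOfFin h 2)) (x (s.orderEmbOfFin h 3))
  else 0

variable {K x}

/-- For `m` below a `3`-set `t = {t₀<t₁<t₂}`: `𝒫₄(insert m t) = 𝒫(x_m,x_{t₀};x_{t₁},x_{t₂})`. [folklore] -/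
theorem pfour_insert {t : Finset ι} (ht : t.card = 3) {m : ι} (hm : ∀ i ∈ t, m < i) :
    pfour K x (insert m t) = Pint K (x m) (x (t.orderEmbOfFin ht 0)) (x (t.orderEmbOfFin ht 1)) (x (t.orderEmbOfFin ht 2)) := by
  have hmt : m ∉ t := fun h => lt_irrefl m (hm m h)
  have h4 : (insert m t).card = 4 := by rw [Finset.card_insert_of_notMem hmt, ht]
  rw [pfour, dif_pos h4]
  have he := orderEmbOfFin_insert_eq_vecCons ht hm h4
  have e0 : (insert m t).orderEmbOfFin h4 0 = m := by
    rw [show ((insert m t).orderEmbOfFin h4 0) = ((insert m t).orderEmbOfFin h4 : Fin 4 → ι) 0 from rfl, he]; rfl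
  have e1 : (insert m t).orderEmbOfFin h4 1 = t.orderEmbOfFin ht 0 := by
    rw [show ((insert m t).orderEmbOfFin h4 1) = ((insert m t).orderEmbOfFin h4 : Fin 4 → ι) 1 from rfl, he]; rfl
  have e2 : (insert m t).orderEmbOfFin h4 2 = t.orderEmbOfFin ht 1 := by
    rw [show ((insert m t).orderEmbOfFin h4 2) = ((insert m t).orderEmbOfFin h4 : Fin 4 → ι) 2 from rfl, he]; rfl
  have e3 : (insert m t).orderEmbOfFin h4 3 = t.orderEmbOfFin ht 2 := by
    rw [show ((insert m t).orderEmbOfFin h4 3) = ((insert m t).orderEmbOfFin h4 : Fin 4 → ι) 3 from rfl, he]; rfl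
  rw [e0, e1, e2, e3]

/-- **The marked functionals regrouped over `3`-subsets** (pairing independence of `𝒫`): with `m = min I`,
`I' = I ∖ m`,
`2 ∑_{b∈I'} marked[𝒫(x_m,x_b;x_·,x_·)](I'∖b) = 6 ∑_{t ⊆ I', |t|=3} 𝒫₄({m} ∪ t) ℰ(I' ∖ t)` — each ordered triple
`(b,i,j)` of `I'` contributes `𝒫(x_m,x_b;x_i,x_j) ℰ(I'∖{b,i,j})`, and the six orderings of a `3`-set contribute
equally (`Pint_swap_bc`, `Pint_swap_cd`). [cite: AizenmanCMP1982, Prop. 12.1 (proof, (12.6)–(12.7)) and Prop. 9.1] -/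
theorem two_mul_sum_marked_eq (hK : ∀ e, 0 ≤ K e) (x : ι → V) {I : Finset ι} (hI : I.Nonempty) :
    2 * ∑ b ∈ I.erase (I.min' hI),
        marked K x (fun i j => Pint K (x (I.min' hI)) (x b) (x i) (x j)) ((I.erase (I.min' hI)).erase b) =
      6 * ∑ t ∈ (I.erase (I.min' hI)).powersetCard 3, pfour K x (insert (I.min' hI) t) * epairing K x (I.erase (I.min' hI) \ t) := by
  set m := I.min' hI with hm
  set I' := I.erase m with hI'
  have hlt : ∀ i ∈ I', m < i := fun i hi =>
    lt_of_le_of_ne (Finset.min'_le I i (Finset.mem_of_mem_erase hi)) (Finset.ne_of_mem_erase hi).symm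
  -- the symmetric set function
  set φ : Finset ι → ℝ≥0∞ := fun t => pfour K x (insert m t) * epairing K x (I' \ t) with hφ
  have hχ : ∀ b ∈ I', ∀ i ∈ I'.erase b, ∀ j ∈ (I'.erase b).erase i,
      Pint K (x m) (x b) (x i) (x j) * epairing K x (((I'.erase b).erase i).erase j) = φ {b, i, j} := by
    intro b hb i hi j hj
    have hib : i ≠ b := Finset.ne_of_mem_erase hi
    have hji : j ≠ i := Finset.ne_of_mem_erase hj
    have hjb : j ≠ b := Finset.ne_of_mem_erase (Finset.mem_of_mem_erase hj)
    have hiI : i ∈ I' := Finset.mem_of_mem_erase hi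
    have hjI : j ∈ I' := Finset.mem_of_mem_erase (Finset.mem_of_mem_erase hj)
    have h3 : ({b, i, j} : Finset ι).card = 3 := by
      rw [Finset.card_insert_of_notMem, Finset.card_insert_of_notMem, Finset.card_singleton]
      · simpa using hji.symm
      · simp only [Finset.mem_insert, Finset.mem_singleton, not_or]; exact ⟨hib.symm, hjb.symm⟩
    have hmt : ∀ k ∈ ({b, i, j} : Finset ι), m < k := fun k hk => by
      simp only [Finset.mem_insert, Finset.mem_singleton] at hk
      rcases hk with rfl | rfl | rfl
      · exact hlt _ hb
      · exact hlt _ hiI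
      · exact hlt _ hjI
    simp only [hφ]
    rw [pfour_insert h3 hmt, erase_erase_erase_eq_sdiff,
      symm3_eq_apply_orderEmbOfFin (fun p q r => Pint K (x m) (x p) (x q) (x r)) (fun p q r => Pint_swap_bc hK _ _ _ _)
        (fun p q r => Pint_swap_cd hK _ _ _ _) h3]
  calc 2 * ∑ b ∈ I', marked K x (fun i j => Pint K (x m) (x b) (x i) (x j)) (I'.erase b)
      = ∑ b ∈ I', ∑ i ∈ I'.erase b, ∑ j ∈ (I'.erase b).erase i,
          Pint K (x m) (x b) (x i) (x j) * epairing K x (((I'.erase b).erase i).erase j) := by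
        rw [Finset.mul_sum]
        refine Finset.sum_congr rfl fun b _ => ?_
        rw [← sum_sum_mul_epairing_eq_two_mul_marked x (fun i j => Pint K (x m) (x b) (x i) (x j))
          (fun i j => Pint_swap_cd hK _ _ _ _) (I'.erase b)]
    _ = ∑ b ∈ I', ∑ i ∈ I'.erase b, ∑ j ∈ (I'.erase b).erase i, φ {b, i, j} :=
        Finset.sum_congr rfl fun b hb => Finset.sum_congr rfl fun i hi => Finset.sum_congr rfl fun j hj => hχ b hb i hi j hj
    _ = 6 • ∑ t ∈ I'.powersetCard 3, φ t := sum_sum_sum_erase_eq_six_nsmul I' φ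
    _ = 6 * ∑ t ∈ I'.powersetCard 3, pfour K x (insert m t) * epairing K x (I' \ t) := by rw [nsmul_eq_mul]; rfl

/-- **The one-step excess bound in terms of `4`-subsets** (Aizenman's `(3/2)|U₄|`, unnormalised): with
`m = min I`, `I' = I∖m`,
`∑_{b∈I'} Z[{x_m}Δ{x_b}] 𝔇(I'∖b;∅) ≤ 𝔇(I;∅) + 3 ∑_{t⊆I',|t|=3} 𝒫₄({m}∪t) ℰ(I'∖t)`.
[cite: AizenmanCMP1982, Prop. 12.1, upper bound of (12.3)] -/
theorem gaussianStep_dcMass_le_three (hK : ∀ e, 0 ≤ K e) (x : ι → V) {I : Finset ι} (hI : I.Nonempty) :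
    ∑ b ∈ I.erase (I.min' hI), ecurrentSum K ({x (I.min' hI)} ∆ {x b}) * dcMass K x ((I.erase (I.min' hI)).erase b) ∅ ≤
      dcMass K x I ∅ + 3 * ∑ t ∈ (I.erase (I.min' hI)).powersetCard 3,
        pfour K x (insert (I.min' hI) t) * epairing K x (I.erase (I.min' hI) \ t) := by
  refine (gaussianStep_dcMass_le x hI).trans (add_le_add le_rfl (le_of_eq ?_))
  have h := two_mul_sum_marked_eq hK x hI
  have h6 : (6 : ℝ≥0∞) = 2 * 3 := by norm_num
  rw [h6, mul_assoc] at h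
  exact (ENNReal.mul_right_inj two_ne_zero ENNReal.ofNat_ne_top).1 h

end FourSets

end Current

end Literature.Probability.LatticeModels

end
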